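import Summits.MatrixMultiplication.OmegaCensus.SmallFormats.InvertiblePointDeltaLawPrep
import Summits.MatrixMultiplication.OmegaCensus.SmallFormats.KroneckerMain
import Summits.MatrixMultiplication.OmegaCensus.SmallFormats.MatMul225GF3CensusReduction
import HarnessLib

/-!
# ω-census family (a): the δ-LAW — a saturated invertible point of an `r`-term scheme for `⟨2,2,n⟩` forces `3r ≥ 10n + 1`

Cell `pub-omega` (unit `pub-omega-tensor`, gen 34), topic `Summits/MatrixMultiplication/OmegaCensus` (sub-folder
`SmallFormats`). Framing (verbatim): lottery ticket; floor = certified bounds/negative ranges. HONEST FRAMING: a structural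
theorem over an ARBITRARY field, assembling tensor g23/g24's saturated-point ('frame / footprint / δ-engine') identities
(`InvertiblePointFrame`, `InvertiblePointLineColumns`, `InvertiblePointBlockFootprint`), tensor g33's Weierstraß–Kronecker theorem
(`Kronecker.kronecker_blockDecomposition`) and the δ-TABLE (`InvertiblePointDeltaTable`, this generation):

**Theorem (`ten_mul_add_one_le_of_saturated_one`).** Let `β` be a bilinear computation of `X ↦ XY` (`X ∈ k^{2×2}`,
`Y ∈ k^{2×n}`, `n ≥ 1`) with `r` terms, and suppose the invertible-point cap is ATTAINED at `X₀ = 1`: exactly `2n` terms `O`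
have `f_s(1) ≠ 0`. Then `10n + 1 ≤ 3r`.

Proof. Block-decompose the span `𝒲'` of the outputs of the `r − 2n` vanishing terms (a Kronecker module `W ↦ (W₀, W₁)`,
`dim 𝒲' ≤ r − 2n`); its column basis defines jointly injective blocks `W ↦ W M_b` with `W_t M_b ∈ S(blk_b)`. (i) No `L_ε`
block occurs: the off outputs `W_s M_b` span `k^{2×cols}` (frame) but every one of them is a block footprint, whose top-right
entry vanishes (`L_topRight_eq_zero`). (ii) Hence `#{L_ηᵀ blocks} = dim 𝒲' − n ≤ r − 3n` and, by the δ-table,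
`Σ_b δ_b ≤ Σ_b δ(blk_b) ≤ 2·#LT1 + #LT2`. (iii) The δ-engine inequality gives `2n ≤ dim K₀ + (r − 2n)` and
`dim K₀ ≤ Σ_b δ_b`; moreover if an `L₁ᵀ` block (a free column `ρ`) is present, `dim K₀ ≤ Σ_b δ(blk_b) − 1`, since otherwise
`K₀ ⊇ k² ⊗ ρ`, which the frame forbids (`f_s` would be multiplicative, `not_mul_hom_matrix_two`). (iv) Arithmetic:
`4n − r ≤ 2(r − 3n) − 1` or (no `L₁ᵀ`) `4n − r ≤ r − 3n`; either way `10n + 1 ≤ 3r`.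

Consequences (`InvertiblePointDeltaLawCensus`, next file): at `(n, r)` with `3r ≤ 10n` — e.g. the `𝔽₃` census cells
`⟨2,2,6⟩@20`, `⟨2,2,7⟩@23`, and every floor rung `(n, ⌈36n/11⌉)` with `n ≥ 9` — NO scheme has a saturated invertible point:
the invertible line cap improves to `r − 2n − 1`. For `⟨2,2,6⟩@20` over `𝔽₃` this excludes the 1 092 'IP-orbits' of the
X-marginal census by one theorem, without enumeration. Nothing here is a bound on `ω`.
-/

namespace Summit.MatrixMultiplication.OmegaCensus.SmallFormats

open Module Submodule Matrix Kronecker Kronecker.KBlock DeltaBlocks Literature.Computability.AlgebraicComplexity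

namespace DeltaLaw

variable {k : Type*} [Field k] {n : ℕ} {ι : Type*} [Fintype ι] [DecidableEq ι]

/-! ## The δ-law at `X₀ = 1` -/

/-- **The δ-LAW.** If a bilinear computation of `⟨2,2,n⟩` (`n ≥ 1`) with `r` terms attains the invertible-point cap at
`X₀ = 1` (exactly `2n` terms do not vanish at `1`), then `10n + 1 ≤ 3r`. -/
theorem ten_mul_add_one_le_of_saturated_one (hn : 0 < n) (β : BilinComp (mulBilin k 2 2 n) ι) (O : Finset ι)
    (hO : ∀ i, i ∉ O → β.f i 1 = 0) (hO' : ∀ i ∈ O, β.f i 1 ≠ 0) (hcard : O.card = 2 * n) :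
    10 * n + 1 ≤ 3 * Fintype.card ι := by
  classical
  -- 0. the vanishing terms and the span `𝒲'` of their outputs
  set Zs : Finset ι := Finset.univ \ O with hZs
  have hZcard : Zs.card = Fintype.card ι - O.card := by
    rw [hZs, Finset.card_sdiff, Finset.inter_univ, Finset.card_univ]
  have hOle : O.card ≤ Fintype.card ι := Finset.card_le_univ O
  set 𝒲 : Submodule k (Matrix (Fin 2) (Fin n) k) := Submodule.span k (Set.range fun t : Zs => β.w (t : ι)) with h𝒲
  have h𝒲dim : finrank k 𝒲 ≤ Fintype.card ι - O.card := by
    rw [← hZcard, ← Fintype.card_coe Zs]; exact finrank_range_le_card _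
  have hwmem : ∀ t, t ∉ O → β.w t ∈ 𝒲 := fun t ht =>
    Submodule.subset_span ⟨⟨t, Finset.mem_sdiff.mpr ⟨Finset.mem_univ t, ht⟩⟩, rfl⟩
  -- 1. the Kronecker module `W ↦ (W 0, W 1)` on `𝒲` and its block decomposition
  let a : 𝒲 →ₗ[k] (Fin n → k) := (rowLM n 0).comp 𝒲.subtype
  let b : 𝒲 →ₗ[k] (Fin n → k) := (rowLM n 1).comp 𝒲.subtype
  have hab : ∀ u : 𝒲, ∀ s : Fin 2, (u : Matrix (Fin 2) (Fin n) k) s = if s = 0 then a u else b u := by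
    intro u s
    fin_cases s <;> rfl
  obtain ⟨N, blk, e, f, D, -⟩ := kronecker_blockDecomposition a b
  -- 2. the column family is a basis
  let J := Σ i : Fin N, Fin (blk i).cols
  let F : J → (Fin n → k) := fun p => f p.1 p.2
  have hFspan : ⊤ ≤ Submodule.span k (Set.range F) := by
    rintro v -
    obtain ⟨g, hg⟩ := D.span_f v
    rw [hg]
    exact Submodule.sum_mem _ fun i _ => Submodule.sum_mem _ fun c hc =>
      Submodule.smul_mem _ _ (Submodule.subset_span ⟨⟨i, ⟨c, Finset.mem_range.mp hc⟩⟩, rfl⟩)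
  have hnfin : finrank k (Fin n → k) = n := Module.finrank_fin_fun k
  have hFcard : Fintype.card J = finrank k (Fin n → k) := by
    rw [Fintype.card_sigma, ← D.cols_eq]; simp
  let bF := basisOfTopLeSpanOfCardEqFinrank F hFspan hFcard
  have hbF : ∀ p, bF p = F p := fun p => by
    simp [bF, coe_basisOfTopLeSpanOfCardEqFinrank]
  have hcoordf : ∀ (p : J) (i : Fin N) (c : ℕ) (hc : c < (blk i).cols),
      bF.coord p (f i c) = if (⟨i, ⟨c, hc⟩⟩ : J) = p then 1 else 0 := by
    intro p i c hc
    have : f i c = bF ⟨i, ⟨c, hc⟩⟩ := by rw [hbF]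
    rw [this, Basis.coord_apply, Basis.repr_self, Finsupp.single_apply]
  -- 3. the block matrices `M b` (coordinates of the rows in block `b`)
  let M : ∀ i : Fin N, Matrix (Fin n) (Fin (blk i).cols) k := fun i j c => bF.coord ⟨i, c⟩ (Pi.single j 1)
  have hMapply : ∀ i (W : Matrix (Fin 2) (Fin n) k) (s : Fin 2) (c : Fin (blk i).cols),
      (W * M i) s c = bF.coord ⟨i, c⟩ (W s) := by
    intro i W s c
    rw [Matrix.mul_apply]
    conv_rhs => rw [eq_sum_smul_single (W s), map_sum]
    refine Finset.sum_congr rfl fun j _ => ?_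
    rw [map_smul, smul_eq_mul]
  have hM : ∀ W : Matrix (Fin 2) (Fin n) k, (∀ i, W * M i = 0) → W = 0 := by
    intro W hW
    ext s j
    have hz : W s = 0 := by
      refine (bF.forall_coord_eq_zero_iff).mp fun p => ?_
      obtain ⟨i, c⟩ := p
      rw [← hMapply i W s c, hW i, Matrix.zero_apply]
    rw [hz]; rfl
  -- 4. the rows of `𝒲` have their blocks in the standard block spaces
  have heM : ∀ (i b' : Fin N) (r : ℕ) (hr : r < (blk i).rows),
      ((e i r : Matrix (Fin 2) (Fin n) k) * M b') = if h : i = b' then h ▸ (blk i).gen r else 0 := by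
    intro i b' r hr
    ext s c
    rw [hMapply, hab]
    have hA := D.rel_a i r hr
    have hB := D.rel_b i r hr
    by_cases hib : i = b'
    · subst hib
      rw [dif_pos rfl]
      fin_cases s
      · simp only [Fin.zero_eta, Fin.isValue, ↓reduceIte]
        rw [hA, map_sum, gen_zero_apply]
        rw [Finset.sum_eq_single_of_mem (c : ℕ) (Finset.mem_range.mpr c.2)]
        · rw [map_smul, hcoordf _ i c c.2, if_pos rfl, smul_eq_mul, mul_one]
        · intro c' hc' hne
          rw [map_smul, hcoordf _ i c' (Finset.mem_range.mp hc'), if_neg, smul_zero]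
          intro h
          apply hne
          have := congrArg (fun q : J => (q.2 : ℕ)) h
          simpa using this
      · simp only [Fin.mk_one, Fin.isValue, one_ne_zero, ↓reduceIte]
        rw [hB, map_sum, gen_one_apply]
        rw [Finset.sum_eq_single_of_mem (c : ℕ) (Finset.mem_range.mpr c.2)]
        · rw [map_smul, hcoordf _ i c c.2, if_pos rfl, smul_eq_mul, mul_one]
        · intro c' hc' hne
          rw [map_smul, hcoordf _ i c' (Finset.mem_range.mp hc'), if_neg, smul_zero]
          intro h
          apply hne
          have := congrArg (fun q : J => (q.2 : ℕ)) h
          simpa using this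
    · rw [dif_neg hib, Matrix.zero_apply]
      have key : ∀ (G : ℕ → ℕ → k), bF.coord ⟨b', c⟩ (∑ c' ∈ Finset.range (blk i).cols, G r c' • f i c') = 0 := by
        intro G
        rw [map_sum]
        refine Finset.sum_eq_zero fun c' hc' => ?_
        rw [map_smul, hcoordf _ i c' (Finset.mem_range.mp hc'), if_neg, smul_zero]
        intro h
        exact hib (congrArg Sigma.fst h)
      fin_cases s
      · simp only [Fin.zero_eta, Fin.isValue, ↓reduceIte]; rw [hA]; exact key _
      · simp only [Fin.mk_one, Fin.isValue, one_ne_zero, ↓reduceIte]; rw [hB]; exact key _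
  have hWM : ∀ (u : 𝒲) (b' : Fin N), (u : Matrix (Fin 2) (Fin n) k) * M b' ∈ (blk b').space := by
    intro u b'
    obtain ⟨g, hg⟩ := D.span_e u
    have hu : (u : Matrix (Fin 2) (Fin n) k) =
        ∑ i, ∑ r ∈ Finset.range (blk i).rows, g i r • (e i r : Matrix (Fin 2) (Fin n) k) := by
      conv_lhs => rw [hg]
      rw [Submodule.coe_sum]
      refine Finset.sum_congr rfl fun i _ => ?_
      rw [Submodule.coe_sum]
      refine Finset.sum_congr rfl fun r _ => ?_
      rw [Submodule.coe_smul]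
    rw [hu, Matrix.sum_mul]
    refine Submodule.sum_mem _ fun i _ => ?_
    rw [Matrix.sum_mul]
    refine Submodule.sum_mem _ fun r hr => ?_
    rw [Matrix.smul_mul]
    refine Submodule.smul_mem _ _ ?_
    rw [heM i b' r (Finset.mem_range.mp hr)]
    by_cases hib : i = b'
    · subst hib
      rw [dif_pos rfl]
      exact Submodule.subset_span ⟨⟨r, Finset.mem_range.mp hr⟩, rfl⟩
    · rw [dif_neg hib]; exact Submodule.zero_mem _
  have hS : ∀ (b' : Fin N) (t : ι), t ∉ O → β.w t * M b' ∈ (blk b').space := fun b' t ht =>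
    hWM ⟨β.w t, hwmem t ht⟩ b'
  -- 5. no `L_ε` block: the off outputs' blocks span everything and are footprints
  have hsurj : ∀ (b' : Fin N) (B' : Matrix (Fin 2) (Fin (blk b').cols) k),
      ∃ W : Matrix (Fin 2) (Fin n) k, W * M b' = B' := by
    intro b' B'
    refine ⟨fun s => ∑ c, B' s c • f b' c, ?_⟩
    ext s c
    rw [hMapply, map_sum]
    simp_rw [map_smul]
    rw [Finset.sum_eq_single c]
    · rw [hcoordf _ b' c c.2, if_pos rfl, smul_eq_mul, mul_one]
    · intro c' _ hne
      rw [hcoordf _ b' c' c'.2, if_neg, smul_zero]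
      intro h
      apply hne
      have := congrArg (fun q : J => (q.2 : ℕ)) h
      exact Fin.ext (by simpa using this)
    · intro h; exact absurd (Finset.mem_univ c) h
  have noL : ∀ (b' : Fin N) (e' : ℕ), blk b' ≠ KBlock.L e' := by
    intro b'
    refine ne_L_of_footprints (blk b') (Set.range fun s : O => β.w (s : ι) * M b') ?_ ?_
    · -- spanning
      rintro B' -
      obtain ⟨W, hW⟩ := hsurj b' B'
      have hWspan : W ∈ Submodule.span k (Set.range fun i : O => β.w (i : ι)) :=
        top_le_span_w_off β 1 isUnit_det_one_fin_two O hO Submodule.mem_top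
      rw [← hW]
      refine Submodule.span_induction (p := fun W _ => W * M b' ∈ Submodule.span k
          (Set.range fun s : O => β.w (s : ι) * M b')) ?_ ?_ ?_ ?_ hWspan
      · rintro _ ⟨s, rfl⟩; exact Submodule.subset_span ⟨s, rfl⟩
      · rw [Matrix.zero_mul]; exact Submodule.zero_mem _
      · intro x y _ _ hx hy; rw [Matrix.add_mul]; exact Submodule.add_mem _ hx hy
      · intro c x _ hx; rw [Matrix.smul_mul]; exact Submodule.smul_mem _ _ hx
    · rintro _ ⟨s, rfl⟩
      exact ⟨β.f s, hO' s s.2, fun X => block_footprint_mem β O hO hO' hcard (M b') _ (hS b') s.2 X⟩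
  -- 6. the common kernel `K₀` and the δ-bounds
  set K₀ := LinearMap.ker (LinearMap.pi fun t : ↥(Finset.univ \ O) => β.g (t : ι)) with hK₀
  have memK₀ : ∀ W, W ∈ K₀ ↔ ∀ t, t ∉ O → β.g t W = 0 := fun W => by
    rw [hK₀, LinearMap.mem_ker]
    constructor
    · intro h t ht
      have := congr_fun h ⟨t, Finset.mem_sdiff.mpr ⟨Finset.mem_univ t, ht⟩⟩
      simpa using this
    · intro h; funext t; simpa using h t (Finset.mem_sdiff.mp t.2).2
  have hdimK : 2 * n ≤ finrank k K₀ + (Fintype.card ι - O.card) := by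
    have h1 := LinearMap.finrank_range_add_finrank_ker (LinearMap.pi fun t : ↥(Finset.univ \ O) => β.g (t : ι))
    rw [finrank_matrix_fin, ← hK₀] at h1
    have h2 : finrank k (LinearMap.range (LinearMap.pi fun t : ↥(Finset.univ \ O) => β.g (t : ι))) ≤
        Fintype.card ι - O.card := by
      calc finrank k (LinearMap.range (LinearMap.pi fun t : ↥(Finset.univ \ O) => β.g (t : ι)))
          ≤ finrank k (↥(Finset.univ \ O) → k) := Submodule.finrank_le _
        _ = Fintype.card ι - O.card := by
            rw [finrank_fintype_fun_eq_card, Fintype.card_coe, ← hZs, hZcard]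
    omega
  let π : ∀ i : Fin N, Matrix (Fin 2) (Fin n) k →ₗ[k] Matrix (Fin 2) (Fin (blk i).cols) k :=
    fun i => (mulBilin k 2 n (blk i).cols).flip (M i)
  have hπ : ∀ i W, π i W = W * M i := fun i W => by simp [π, LinearMap.flip_apply, mulBilin_apply]
  have hδ : ∀ i, finrank k (K₀.map (π i)) ≤ (blk i).delta := fun i =>
    (finrank_block_map_ker_le β O hO hO' hcard (M i) _ (hS i)).trans
      (finrank_inf_le_delta (blk i) (span_off_le_deltaSpan β.f O hO' _))
  have hKsum : finrank k K₀ ≤ ∑ i, (blk i).delta :=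
    (finrank_le_sum_finrank_map K₀ π fun W _ hW => hM W fun i => by rw [← hπ]; exact hW i).trans
      (Finset.sum_le_sum fun i _ => hδ i)
  -- 7. strictness when an `L₁ᵀ` block (a free column) is present
  have hstrict : ∀ b₀, blk b₀ = KBlock.LT 1 → finrank k K₀ + 1 ≤ ∑ i, (blk i).delta := by
    intro b₀ hb₀
    have hc0 : 0 < (blk b₀).cols := by rw [hb₀]; exact Nat.one_pos
    have hcc : (blk b₀).cols = 1 := by rw [hb₀]; rfl
    set ρ : Fin n → k := f b₀ 0 with hρ
    have hρne : ρ ≠ 0 := by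
      have : ρ = bF ⟨b₀, ⟨0, hc0⟩⟩ := by rw [hbF]
      rw [this]; exact bF.ne_zero _
    -- `E = k² ⊗ ρ`
    let vz : (Fin 2 → k) →ₗ[k] Matrix (Fin 2) (Fin n) k :=
      { toFun := fun z => vecMulVec z ρ
        map_add' := fun z z' => by ext i j; simp [vecMulVec_apply, add_mul]
        map_smul' := fun c z => by ext i j; simp [vecMulVec_apply, mul_assoc] }
    set E := LinearMap.range vz with hE
    have hEdim : finrank k E ≤ 2 := by
      calc finrank k E ≤ finrank k (Fin 2 → k) := LinearMap.finrank_range_le vz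
        _ = 2 := Module.finrank_fin_fun k
    -- `K₀ ⊓ E` has dimension ≤ 1
    have hKE : finrank k ↥(K₀ ⊓ E) ≤ 1 := by
      by_contra hlt
      have h2 : finrank k E ≤ finrank k ↥(K₀ ⊓ E) := by omega
      have hEq : K₀ ⊓ E = E := Submodule.eq_of_le_of_finrank_le inf_le_right h2
      have hEK : E ≤ K₀ := hEq ▸ inf_le_left
      refine not_forall_vecMulVec_mem_ker β O hO hO' hcard hρne fun z t ht => ?_
      exact (memK₀ _).mp (hEK ⟨z, rfl⟩) t ht
    -- the map `K₀ → Π_{i ≠ b₀} K₀.map (π i)`; its kernel lies in `K₀ ⊓ E`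
    let ψ : K₀ →ₗ[k] (∀ i : {i : Fin N // i ≠ b₀}, ↥(K₀.map (π i))) :=
      LinearMap.pi fun i => LinearMap.codRestrict (K₀.map (π i)) ((π i).domRestrict K₀)
        fun W => Submodule.mem_map_of_mem W.2
    have hkerψ : ∀ W : K₀, ψ W = 0 → (W : Matrix (Fin 2) (Fin n) k) ∈ E := by
      intro W hW
      have hWi : ∀ i, i ≠ b₀ → (W : Matrix (Fin 2) (Fin n) k) * M i = 0 := by
        intro i hi
        have := congr_fun hW ⟨i, hi⟩
        rw [Pi.zero_apply] at this
        have h' := congrArg (fun x : ↥(K₀.map (π i)) => (x : Matrix (Fin 2) (Fin (blk i).cols) k)) this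
        simpa [ψ, hπ] using h'
      -- every row of `W` is a multiple of `ρ`
      refine ⟨fun s => bF.coord ⟨b₀, ⟨0, hc0⟩⟩ ((W : Matrix (Fin 2) (Fin n) k) s), ?_⟩
      change vecMulVec _ ρ = _
      ext s j
      rw [vecMulVec_apply]
      have hexp := (bF.sum_repr ((W : Matrix (Fin 2) (Fin n) k) s)).symm
      have hrow : (W : Matrix (Fin 2) (Fin n) k) s = bF.coord ⟨b₀, ⟨0, hc0⟩⟩ ((W : Matrix (Fin 2) (Fin n) k) s) • ρ := by
        conv_lhs => rw [hexp]
        rw [Finset.sum_eq_single (⟨b₀, ⟨0, hc0⟩⟩ : J)]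
        · rw [hbF]; rfl
        · rintro ⟨i, c⟩ - hne
          by_cases hi : i = b₀
          · subst hi
            exfalso; apply hne
            have hc : c = ⟨0, hc0⟩ := by
              apply Fin.ext
              have h1 : (c : ℕ) < 1 := lt_of_lt_of_eq c.2 hcc
              change (c : ℕ) = 0
              omega
            rw [hc]
          · have : bF.repr ((W : Matrix (Fin 2) (Fin n) k) s) ⟨i, c⟩ = 0 := by
              rw [← Basis.coord_apply, ← hMapply i _ s c, hWi i hi, Matrix.zero_apply]
            rw [this, zero_smul]
        · intro h; exact absurd (Finset.mem_univ _) h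
      have := congr_fun hrow j
      rw [Pi.smul_apply, smul_eq_mul] at this
      exact this.symm
    have hkerle : finrank k (LinearMap.ker ψ) ≤ 1 := by
      let θ : LinearMap.ker ψ →ₗ[k] ↥(K₀ ⊓ E) :=
        { toFun := fun W => ⟨(W : K₀), (W : K₀).2, hkerψ W (LinearMap.mem_ker.mp W.2)⟩
          map_add' := fun _ _ => rfl
          map_smul' := fun _ _ => rfl }
      have hθ : Function.Injective θ := by
        intro W W' h
        apply Subtype.ext; apply Subtype.ext
        exact congrArg (fun x : ↥(K₀ ⊓ E) => (x : Matrix (Fin 2) (Fin n) k)) h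
      exact (LinearMap.finrank_le_finrank_of_injective hθ).trans hKE
    have hrange : finrank k (LinearMap.range ψ) ≤ ∑ i : {i : Fin N // i ≠ b₀}, (blk i).delta := by
      calc finrank k (LinearMap.range ψ) ≤ finrank k (∀ i : {i : Fin N // i ≠ b₀}, ↥(K₀.map (π i))) :=
            Submodule.finrank_le _
        _ = ∑ i : {i : Fin N // i ≠ b₀}, finrank k ↥(K₀.map (π i)) := Module.finrank_pi_fintype k
        _ ≤ _ := Finset.sum_le_sum fun i _ => hδ i
    have hrn := LinearMap.finrank_range_add_finrank_ker ψ
    have hsplit : ∑ i, (blk i).delta = (blk b₀).delta + ∑ i : {i : Fin N // i ≠ b₀}, (blk i).delta := by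
      rw [Fintype.sum_eq_add_sum_compl b₀]
      congr 1
      exact Finset.sum_subtype _ (fun i => by simp [Finset.mem_compl]) (fun i => (blk i).delta)
    have hd0 : (blk b₀).delta = 2 := by rw [hb₀]; rfl
    omega
  -- 8. counting
  have hrows : ∑ i, (blk i).rows = finrank k 𝒲 := D.rows_eq
  have hcols : ∑ i, (blk i).cols = n := by rw [D.cols_eq, hnfin]
  have hsum2 : ∑ i, (blk i).delta + 2 * ∑ i, (blk i).cols ≤ 2 * ∑ i, (blk i).rows := by
    rw [Finset.mul_sum, Finset.mul_sum, ← Finset.sum_add_distrib]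
    exact Finset.sum_le_sum fun i _ => delta_add_le_of_ne_L (blk i) (noL i)
  by_cases hLT1 : ∃ b₀, blk b₀ = KBlock.LT 1
  · obtain ⟨b₀, hb₀⟩ := hLT1
    have := hstrict b₀ hb₀
    omega
  · push Not at hLT1
    have hsum1 : ∑ i, (blk i).delta + ∑ i, (blk i).cols ≤ ∑ i, (blk i).rows := by
      rw [← Finset.sum_add_distrib]
      exact Finset.sum_le_sum fun i _ => delta_add_le_of_ne_LT_one (blk i) (noL i) (hLT1 i)
    omega


/-! ## Any invertible point; the census form -/

section Census

open Summit.MatrixMultiplication.OmegaCensus.RankOnePlaneCapGeneral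

variable [DecidableEq k]

/-- **The δ-LAW at any invertible point.** If a bilinear computation of `⟨2,2,n⟩` (`n ≥ 1`) with `r` terms has an
invertible `X₀` at which exactly `2n` X-forms do not vanish (a SATURATED invertible point), then `10n + 1 ≤ 3r`.
(Transport `X ↦ X₀X` to `X₀ = 1` by `exists_XsideTransform`.) -/
theorem ten_mul_add_one_le_of_saturated (hn : 0 < n) (β : BilinComp (mulBilin k 2 2 n) ι)
    (X₀ : Matrix (Fin 2) (Fin 2) k) (hX₀ : IsUnit X₀.det)
    (hsat : (Finset.univ.filter fun i => β.f i X₀ ≠ 0).card = 2 * n) : 10 * n + 1 ≤ 3 * Fintype.card ι := by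
  classical
  obtain ⟨β', hf, -, -⟩ := exists_XsideTransform β X₀ X₀⁻¹ 1 1 (Matrix.mul_nonsing_inv X₀ hX₀) (Matrix.one_mul 1)
  have hf1 : ∀ i, β'.f i 1 = β.f i X₀ := fun i => by rw [hf, Matrix.mul_one, Matrix.mul_one]
  refine ten_mul_add_one_le_of_saturated_one hn β' (Finset.univ.filter fun i => β.f i X₀ ≠ 0) ?_ ?_ hsat
  · intro i hi
    rw [hf1]
    by_contra h
    exact hi (Finset.mem_filter.mpr ⟨Finset.mem_univ i, h⟩)
  · intro i hi
    rw [hf1]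
    exact (Finset.mem_filter.mp hi).2

/-- **Census form of the δ-law.** If `3r ≤ 10n` (`n ≥ 1`), an `r`-term computation of `⟨2,2,n⟩` has NO saturated
invertible point: at every invertible `X₀` at least `2n + 1` X-forms do not vanish, i.e. at most `r − 2n − 1` vanish —
the invertible line cap of the X-marginal census improved by one. -/
theorem two_mul_add_one_le_card_filter_ne (hn : 0 < n) (β : BilinComp (mulBilin k 2 2 n) ι)
    (h3 : 3 * Fintype.card ι ≤ 10 * n) (X₀ : Matrix (Fin 2) (Fin 2) k) (hX₀ : IsUnit X₀.det) :
    2 * n + 1 ≤ (Finset.univ.filter fun i => β.f i X₀ ≠ 0).card := by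
  have h1 : 2 * n ≤ (Finset.univ.filter fun i => β.f i X₀ ≠ 0).card := by
    convert two_mul_le_card_filter_ne β X₀ hX₀
  rcases Nat.lt_or_ge (2 * n) (Finset.univ.filter fun i => β.f i X₀ ≠ 0).card with h | h
  · exact h
  · have heq : (Finset.univ.filter fun i => β.f i X₀ ≠ 0).card = 2 * n := le_antisymm h h1
    have := ten_mul_add_one_le_of_saturated hn β X₀ hX₀ heq
    omega

/-- **`⟨2,2,6⟩` with 20 terms (any field): no saturated invertible point** — at every invertible `X₀` at least 13 of the
20 X-forms do not vanish (at most 7 vanish; the cap alone allows 8). Over `𝔽₃` this excludes the 1 092 'IP-orbits' of the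
X-marginal census `⟨2,2,6⟩@20` by one theorem, with no enumeration and no engine. -/
theorem thirteen_le_card_filter_ne_226 (β : BilinComp (mulBilin k 2 2 6) ι) (hι : Fintype.card ι = 20)
    (X₀ : Matrix (Fin 2) (Fin 2) k) (hX₀ : IsUnit X₀.det) :
    13 ≤ (Finset.univ.filter fun i => β.f i X₀ ≠ 0).card :=
  two_mul_add_one_le_card_filter_ne (by norm_num) β (by rw [hι]) X₀ hX₀

/-- **`⟨2,2,7⟩` with 23 terms (any field): no saturated invertible point** (at least 15 of the 23 X-forms do not vanish
at any invertible `X₀`). -/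
theorem fifteen_le_card_filter_ne_227 (β : BilinComp (mulBilin k 2 2 7) ι) (hι : Fintype.card ι = 23)
    (X₀ : Matrix (Fin 2) (Fin 2) k) (hX₀ : IsUnit X₀.det) :
    15 ≤ (Finset.univ.filter fun i => β.f i X₀ ≠ 0).card :=
  two_mul_add_one_le_card_filter_ne (by norm_num) β (by rw [hι]; norm_num) X₀ hX₀

end Census

end DeltaLaw

end Summit.MatrixMultiplication.OmegaCensus.SmallFormats
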